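import Literature.InformationTheory.QuantumCodes.TwoBlockWheelGraphs
import HarnessLib

/-!
# Every component of a layer of a weight-(3,3) two-block Tanner graph is a wheel graph
# (Bravyi et al. 2024, Lemma 2 minus planarity), part 2

Continuation of `TwoBlockWheelGraphs.lean`. [BravyiEtAl2024, §5, proof of Lemma 2]: "We claim that
each connected component of `G_A` can be represented by a 'wheel graph' … wheel graphs are planar …
Thus `G_A` and `G_B` are planar."

PROVED here (every finite abelian `G`, `AbelianTwoBlock.css a b`; BB = `ℤ_ℓ × ℤ_m`):

* `wheelIso` / **`nonempty_iso_prism_of_pair21`**: for a (2,1)-pair (`supp a = {s, s'}`, `s ≠ s'`,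
  `supp b = {t}` — the printed layer `H^X_A = [A₂+A₃ | B₃]`, `H^Z_A = [B₃ᵀ | A₂ᵀ+A₃ᵀ]`) EVERY connected
  component of the Tanner graph is isomorphic to the wheel graph `prismGraph (2 · ord(s' − s))`
  (`2 · ord(A₃A₂ᵀ)` cycle positions: the printed "length … equal to the order of `A₃A₂ᵀ`" counts the
  `X`-checks (equivalently the `L`-qubits) on the outer cycle);
* **`nonempty_iso_prism_of_pair12`**: the same for a (1,2)-pair (`H^X_B = [A₁ | B₁+B₂]`), by the
  tree's `X ↔ Z` duality `css_dual_eq_swap` + `CSSCode.tannerGraphSwapIso`, with `ord(B₂B₁ᵀ)`;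
* **`exists_wheel_layers`** — Lemma 2 minus planarity for every weight-(3,3) abelian two-block code
  with pairwise distinct terms (`supp a = {s₁,s₂,s₃}`, `supp b = {t₁,t₂,t₃}`): the Tanner graph is the
  EDGE-DISJOINT union `Γ_A ⊔ Γ_B` of the Tanner graphs of the (2,1)-pair `({s₂,s₃}, {t₃})` and the
  (1,2)-pair `({s₁}, {t₁,t₂})`, every component of `Γ_A` is `≅ prismGraph (2·ord(s₃−s₂))` and every
  component of `Γ_B` is `≅ prismGraph (2·ord(t₂−t₁))`.  What is NOT concluded: "thickness ≤ 2" — the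
  planarity of wheel graphs has no Mathlib counterpart (the census tag `layout=thickness≤2:BCGMRY24-L2`
  therefore reads: kernel structure theorem `exists_wheel_layers` + the pictorial planarity of
  `C_{2p} □ K₂`).

## References (locators read on the page)
* [BravyiEtAl2024] Nature 627 (2024) 778 = arXiv:2308.07915, §5 Lemma 2 and its proof (held text
  paper:arxiv-2308.07915 chunk p0010 L49–95, p0011 L1–5).

No named facts, no instances, no notation.
-/

namespace Literature.InformationTheory.QuantumCodes

open SimpleGraph

/-- Equal graphs are isomorphic (transport along an equation of `SimpleGraph`s on one vertex type).
[folklore] -/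
private def isoOfEq {V : Type*} {Γ₁ Γ₂ : SimpleGraph V} (h : Γ₁ = Γ₂) : Γ₁ ≃g Γ₂ where
  toEquiv := Equiv.refl V
  map_rel_iff' := fun {u v} => by rw [h]; rfl

namespace AbelianTwoBlock

variable {G : Type*} [Fintype G] [AddCommGroup G]

section Component

variable {a b : G → ZMod 2} {s s' t : G}
  (ha : ∀ g, a g ≠ 0 ↔ g = s ∨ g = s') (hss : s ≠ s') (hb : ∀ g, b g ≠ 0 ↔ g = t)
include ha hss hb

omit ha hss hb in
/-- The wheel starts at `X i`: position `(0, outer)`. [cite: BravyiEtAl2024, proof of Lemma 2 (arXiv:2308.07915 chunk p0010 L74–76)] -/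
theorem wheelMap_zero (i : G) : wheelMap s s' t i (0, false) = vX i := by
  haveI : NeZero (addOrderOf (s' - s)) := ⟨(addOrderOf_pos _).ne'⟩
  have hp : par (0 : ZMod (2 * addOrderOf (s' - s))) = false := by simp [par]
  have hh : half (0 : ZMod (2 * addOrderOf (s' - s))) = 0 := by simp [half]
  rw [wheelMap_apply, hp, hh, wheelVertex]
  simp [torusHom_apply]

omit hss in
/-- Every wheel vertex is reachable from `X i` (walk along the outer cycle, then a radial edge).
[cite: BravyiEtAl2024, proof of Lemma 2 (arXiv:2308.07915 chunk p0010 L74–93)] -/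
theorem reachable_vX_wheelMap (i : G) (u : ZMod (2 * addOrderOf (s' - s)) × Bool) :
    (css a b).tannerGraph.Reachable (vX i) (wheelMap s s' t i u) := by
  haveI : NeZero (addOrderOf (s' - s)) := ⟨(addOrderOf_pos _).ne'⟩
  haveI : NeZero (2 * addOrderOf (s' - s)) := ⟨by have := addOrderOf_pos (s' - s); omega⟩
  have hs : a s ≠ 0 := (ha s).mpr (Or.inl rfl)
  have hs' : a s' ≠ 0 := (ha s').mpr (Or.inr rfl)
  have ht : b t ≠ 0 := (hb t).mpr rfl
  have outer : ∀ k : ℕ, (css a b).tannerGraph.Reachable (vX i)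
      (wheelMap s s' t i (((k : ℕ) : ZMod (2 * addOrderOf (s' - s))), false)) := by
    intro k
    induction k with
    | zero => rw [Nat.cast_zero, wheelMap_zero]
    | succ k ih =>
      rw [Nat.cast_succ]
      exact ih.trans (wheelMap_adj_add_one hs hs' i _ false).reachable
  obtain ⟨c, β⟩ := u
  have hc := outer c.val
  rw [ZMod.natCast_zmod_val] at hc
  cases β
  · exact hc
  · exact hc.trans (wheelMap_adj_spoke ht i c).reachable

/-- **The wheel is a whole connected component**: the image of the wheel map through `X i` is exactly
the support of the connected component of `X i`.
[cite: BravyiEtAl2024, proof of Lemma 2 "each connected component of G_A can be represented by a wheel graph" (arXiv:2308.07915 chunk p0010 L71)] -/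
theorem range_wheelMap_eq_supp (i : G) :
    Set.range (wheelMap s s' t i) = ((css a b).tannerGraph.connectedComponentMk (vX i)).supp := by
  ext v
  rw [ConnectedComponent.mem_supp_iff, ConnectedComponent.eq]
  constructor
  · rintro ⟨u, rfl⟩
    exact (reachable_vX_wheelMap ha hb i u).symm
  · intro hv
    -- walk induction: the image is closed under taking neighbours
    suffices key : ∀ x y : (G ⊕ G) ⊕ (G ⊕ G), (css a b).tannerGraph.Reachable x y →
        x ∈ Set.range (wheelMap s s' t i) → y ∈ Set.range (wheelMap s s' t i) from
      key _ _ hv.symm ⟨(0, false), wheelMap_zero i⟩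
    intro x y hxy
    obtain ⟨p⟩ := hxy
    induction p with
    | nil => exact id
    | cons hadj _ ih =>
      rintro ⟨u, rfl⟩
      obtain ⟨u', -, hu'⟩ := exists_prism_adj_of_adj_wheelMap ha hss hb i u _ hadj
      exact ih ⟨u', hu'⟩

/-- **The connected component of `X i` is isomorphic to the wheel graph** `prismGraph (2·ord(s' − s))`,
via the wheel map. [cite: BravyiEtAl2024, proof of Lemma 2 "each connected component of G_A can be represented by a wheel graph" (arXiv:2308.07915 chunk p0010 L71–93)] -/
noncomputable def wheelIso (i : G) :
    prismGraph (2 * addOrderOf (s' - s)) ≃g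
      ((css a b).tannerGraph.connectedComponentMk (vX i)).toSimpleGraph where
  toEquiv := Equiv.ofBijective
    (fun u => ⟨wheelMap s s' t i u,
      show wheelMap s s' t i u ∈ ((css a b).tannerGraph.connectedComponentMk (vX i)).supp from
        (range_wheelMap_eq_supp ha hss hb i) ▸ Set.mem_range_self u⟩)
    ⟨fun u v h => wheelMap_injective s s' t i (congrArg Subtype.val h),
      fun ⟨v, hv⟩ => by
        change v ∈ ((css a b).tannerGraph.connectedComponentMk (vX i)).supp at hv
        rw [← range_wheelMap_eq_supp ha hss hb i] at hv
        obtain ⟨u, rfl⟩ := hv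
        exact ⟨u, rfl⟩⟩
  map_rel_iff' := by
    intro u v
    simp only [Equiv.ofBijective_apply, ConnectedComponent.toSimpleGraph, induce_adj]
    constructor
    · intro h
      obtain ⟨u', hadj, hu'⟩ := exists_prism_adj_of_adj_wheelMap ha hss hb i u _ h
      rwa [← wheelMap_injective s s' t i hu']
    · exact wheelMap_adj_of_prism_adj ((ha s).mpr (Or.inl rfl)) ((ha s').mpr (Or.inr rfl))
        ((hb t).mpr rfl) i

/-- **Every connected component of the Tanner graph of a (2,1)-pair is a wheel graph** with
`2 · ord(s' − s)` positions per cycle ("the length of the outer cycle is equal to the order of the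
matrix `A₃A₂ᵀ`" counted in `X`-checks; "all components" because every component contains an `X`-check).
[cite: BravyiEtAl2024, proof of Lemma 2 (arXiv:2308.07915 chunk p0010 L71–93)] -/
theorem nonempty_iso_prism_of_pair21 (C : (css a b).tannerGraph.ConnectedComponent) :
    Nonempty (C.toSimpleGraph ≃g prismGraph (2 * addOrderOf (s' - s))) := by
  have ha0 : a ≠ 0 := fun h => ((ha s).mpr (Or.inl rfl)) (by simp [h])
  have hb0 : b ≠ 0 := fun h => ((hb t).mpr rfl) (by simp [h])
  obtain ⟨g, rfl⟩ := exists_vL_mem ha0 hb0 C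
  have hadj : (css a b).tannerGraph.Adj (vL g) (vX (s + g)) := by
    rw [adj_vL_iff_pair21 ha hb]; exact Or.inl rfl
  rw [ConnectedComponent.sound hadj.reachable]
  exact ⟨(wheelIso ha hss hb (s + g)).symm⟩

end Component

/-- **The (1,2)-layer `[A₁ | B₁+B₂]`**: for `supp a = {s}`, `supp b = {t, t'}` (`t ≠ t'`) every connected
component of the Tanner graph is a wheel graph with `2 · ord(t' − t)` positions per cycle — by the
`X ↔ Z` duality `css b(−·) a(−·) = (css a b).swap`, which exchanges the roles of the two blocks.
[cite: BravyiEtAl2024, proof of Lemma 2 "G_A and G_B … Thus G_A and G_B are planar" (the argument for G_B is the same as for G_A; arXiv:2308.07915 chunk p0010 L56–62, p0011 L1–5)] -/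
theorem nonempty_iso_prism_of_pair12 {a b : G → ZMod 2} {s t t' : G} (ha : ∀ g, a g ≠ 0 ↔ g = s)
    (htt : t ≠ t') (hb : ∀ g, b g ≠ 0 ↔ g = t ∨ g = t')
    (C : (css a b).tannerGraph.ConnectedComponent) :
    Nonempty (C.toSimpleGraph ≃g prismGraph (2 * addOrderOf (t' - t))) := by
  -- the dual (2,1)-pair `(b(−·), a(−·))` with `s ↦ −t'`, `s' ↦ −t`, `t ↦ −s`
  have ha' : ∀ g, (fun g => b (-g)) g ≠ 0 ↔ g = -t' ∨ g = -t := by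
    intro g; simp only [hb (-g), neg_eq_iff_eq_neg]; tauto
  have hb' : ∀ g, (fun g => a (-g)) g ≠ 0 ↔ g = -s := by
    intro g; simp only [ha (-g), neg_eq_iff_eq_neg]
  have hss : -t' ≠ -t := fun h => htt (neg_injective h).symm
  have e : (css (fun g => b (-g)) (fun g => a (-g))).tannerGraph = (css a b).swap.tannerGraph := by
    rw [css_dual_eq_swap]
  let φ : (css (fun g => b (-g)) (fun g => a (-g))).tannerGraph ≃g (css a b).tannerGraph :=
    (isoOfEq e).trans (CSSCode.tannerGraphSwapIso (css a b))
  obtain ⟨ψ⟩ := nonempty_iso_prism_of_pair21 ha' hss hb' (φ.symm.connectedComponentEquiv C)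
  have hδ : -t - -t' = t' - t := by abel
  rw [hδ] at ψ
  exact ⟨(componentIsoOfIso φ.symm C).trans ψ⟩

/-! ### Lemma 2 (minus planarity) for weight-(3,3) codes -/

/-- Over `𝔽₂`, non-zero means one. [folklore] -/
private theorem zmod2_ne_zero_iff (x : ZMod 2) : x ≠ 0 ↔ x = 1 := by
  revert x; decide

/-- **Lemma 2 without its last sentence** ("wheel graphs are planar"): for every weight-(3,3) abelian
two-block code with pairwise distinct terms — `supp a = {s₁, s₂, s₃}`, `supp b = {t₁, t₂, t₃}` — the
Tanner graph is the edge-disjoint union of two spanning layers, `Γ_A` = the Tanner graph of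
`[A₂+A₃ | B₃]` and `Γ_B` = that of `[A₁ | B₁+B₂]`, and every connected component of `Γ_A` (resp. `Γ_B`)
is isomorphic to the wheel graph `prismGraph (2·ord(s₃−s₂))` (resp. `prismGraph (2·ord(t₂−t₁))`) —
two cycles joined by radial edges, a 3-regular graph. (Thickness `≤ 2` would follow from the
planarity of wheel graphs, which is not expressible in Mathlib.)
[cite: BravyiEtAl2024, Lemma 2 and proof (arXiv:2308.07915 chunk p0010 L49–95, p0011 L1–5)] -/
theorem exists_wheel_layers {a b : G → ZMod 2} {s₁ s₂ s₃ t₁ t₂ t₃ : G}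
    (hs₁₂ : s₁ ≠ s₂) (hs₁₃ : s₁ ≠ s₃) (hs₂₃ : s₂ ≠ s₃) (ht₁₂ : t₁ ≠ t₂) (ht₁₃ : t₁ ≠ t₃) (ht₂₃ : t₂ ≠ t₃)
    (ha : ∀ g, a g ≠ 0 ↔ g = s₁ ∨ g = s₂ ∨ g = s₃) (hb : ∀ g, b g ≠ 0 ↔ g = t₁ ∨ g = t₂ ∨ g = t₃) :
    ∃ ΓA ΓB : SimpleGraph ((G ⊕ G) ⊕ (G ⊕ G)),
      (css a b).tannerGraph = ΓA ⊔ ΓB ∧ Disjoint ΓA ΓB ∧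
      (∀ C : ΓA.ConnectedComponent, Nonempty (C.toSimpleGraph ≃g prismGraph (2 * addOrderOf (s₃ - s₂)))) ∧
      (∀ C : ΓB.ConnectedComponent, Nonempty (C.toSimpleGraph ≃g prismGraph (2 * addOrderOf (t₂ - t₁)))) := by
  classical
  -- the four pieces of the supports
  let a₂₃ : G → ZMod 2 := fun g => if g = s₂ ∨ g = s₃ then 1 else 0
  let a₁ : G → ZMod 2 := fun g => if g = s₁ then 1 else 0
  let b₃ : G → ZMod 2 := fun g => if g = t₃ then 1 else 0
  let b₁₂ : G → ZMod 2 := fun g => if g = t₁ ∨ g = t₂ then 1 else 0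
  have ha_split : a = a₂₃ + a₁ := by
    funext g
    simp only [Pi.add_apply, a₂₃, a₁]
    by_cases h : a g = 0
    · have hg : ¬ (g = s₁ ∨ g = s₂ ∨ g = s₃) := fun h' => ((ha g).mpr h') h
      simp only [not_or] at hg
      simp [h, hg.1, hg.2.1, hg.2.2]
    · have h1 : a g = 1 := (zmod2_ne_zero_iff _).mp h
      rcases (ha g).mp h with rfl | rfl | rfl
      · simp [h1, hs₁₂, hs₁₃]
      · simp [h1, hs₁₂.symm]
      · simp [h1, hs₁₃.symm]
  have hb_split : b = b₃ + b₁₂ := by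
    funext g
    simp only [Pi.add_apply, b₃, b₁₂]
    by_cases h : b g = 0
    · have hg : ¬ (g = t₁ ∨ g = t₂ ∨ g = t₃) := fun h' => ((hb g).mpr h') h
      simp only [not_or] at hg
      simp [h, hg.1, hg.2.1, hg.2.2]
    · have h1 : b g = 1 := (zmod2_ne_zero_iff _).mp h
      rcases (hb g).mp h with rfl | rfl | rfl
      · simp [h1, ht₁₃, ht₁₂]
      · simp [h1, ht₂₃, ht₁₂.symm]
      · simp [h1, ht₁₃.symm, ht₂₃.symm]
  have hdisjA : ∀ g, a₂₃ g = 0 ∨ a₁ g = 0 := by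
    intro g; simp only [a₂₃, a₁]
    by_cases h : g = s₁
    · subst h; simp [hs₁₂, hs₁₃]
    · simp [h]
  have hdisjB : ∀ g, b₃ g = 0 ∨ b₁₂ g = 0 := by
    intro g; simp only [b₃, b₁₂]
    by_cases h : g = t₃
    · subst h; simp [ht₁₃.symm, ht₂₃.symm]
    · simp [h]
  have ha₂₃ : ∀ g, a₂₃ g ≠ 0 ↔ g = s₂ ∨ g = s₃ := by
    intro g; simp only [a₂₃, ne_eq, ite_eq_right_iff, one_ne_zero, imp_false, not_not]
  have hb₃ : ∀ g, b₃ g ≠ 0 ↔ g = t₃ := by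
    intro g; simp only [b₃, ne_eq, ite_eq_right_iff, one_ne_zero, imp_false, not_not]
  have ha₁ : ∀ g, a₁ g ≠ 0 ↔ g = s₁ := by
    intro g; simp only [a₁, ne_eq, ite_eq_right_iff, one_ne_zero, imp_false, not_not]
  have hb₁₂ : ∀ g, b₁₂ g ≠ 0 ↔ g = t₁ ∨ g = t₂ := by
    intro g; simp only [b₁₂, ne_eq, ite_eq_right_iff, one_ne_zero, imp_false, not_not]
  refine ⟨(css a₂₃ b₃).tannerGraph, (css a₁ b₁₂).tannerGraph, ?_, ?_, ?_, ?_⟩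
  · rw [ha_split, hb_split]; exact tannerGraph_eq_sup_of_add a₂₃ a₁ b₃ b₁₂ hdisjA hdisjB
  · exact tannerGraph_disjoint_of_add a₂₃ a₁ b₃ b₁₂ hdisjA hdisjB
  · exact nonempty_iso_prism_of_pair21 ha₂₃ hs₂₃ hb₃
  · exact nonempty_iso_prism_of_pair12 ha₁ ht₁₂ hb₁₂

end AbelianTwoBlock

/-! ### Bivariate-bicycle phrasing -/

namespace BB

/-- The support of a sum of three DISTINCT monomials is the set of the three exponents ("we also assume
the `Aᵢ` are distinct"). [cite: BravyiEtAl2024, §4 "A = A₁ + A₂ + A₃ … each matrix Aᵢ is a power of x or y … distinct" (arXiv:2308.07915 chunk p0009 L20–24)] -/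
theorem three_monomials_apply_ne_zero_iff {ℓ m : ℕ} (a₁ : Fin ℓ) (b₁ : Fin m) (a₂ : Fin ℓ) (b₂ : Fin m)
    (a₃ : Fin ℓ) (b₃ : Fin m) (h₁₂ : (a₁, b₁) ≠ (a₂, b₂)) (h₁₃ : (a₁, b₁) ≠ (a₃, b₃))
    (h₂₃ : (a₂, b₂) ≠ (a₃, b₃)) (g : Mono ℓ m) :
    (monomial a₁ b₁ + monomial a₂ b₂ + monomial a₃ b₃) g ≠ 0 ↔
      g = (a₁, b₁) ∨ g = (a₂, b₂) ∨ g = (a₃, b₃) := by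
  simp only [monomial, Pi.add_apply, Pi.single_apply]
  by_cases e₁ : g = (a₁, b₁)
  · have e₂ : ¬ g = (a₂, b₂) := fun h => h₁₂ (e₁.symm.trans h)
    have e₃ : ¬ g = (a₃, b₃) := fun h => h₁₃ (e₁.symm.trans h)
    rw [if_pos e₁, if_neg e₂, if_neg e₃]
    exact ⟨fun _ => Or.inl e₁, fun _ => by decide⟩
  by_cases e₂ : g = (a₂, b₂)
  · have e₃ : ¬ g = (a₃, b₃) := fun h => h₂₃ (e₂.symm.trans h)
    rw [if_neg e₁, if_pos e₂, if_neg e₃]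
    exact ⟨fun _ => Or.inr (Or.inl e₂), fun _ => by decide⟩
  by_cases e₃ : g = (a₃, b₃)
  · rw [if_neg e₁, if_neg e₂, if_pos e₃]
    exact ⟨fun _ => Or.inr (Or.inr e₃), fun _ => by decide⟩
  · rw [if_neg e₁, if_neg e₂, if_neg e₃]
    simp [e₁, e₂, e₃]

end BB

namespace BB.Code

open AbelianTwoBlock

variable {ℓ m : ℕ} [NeZero ℓ] [NeZero m] (C : Code ℓ m)

/-- **Lemma 2 minus planarity for `QC(A,B)`**: if `A = x^{α₁}y^{β₁} + x^{α₂}y^{β₂} + x^{α₃}y^{β₃}` and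
`B` likewise, with pairwise distinct exponents `g₁, g₂, g₃` resp. `h₁, h₂, h₃`, the Tanner graph of
`QC(A,B)` is the edge-disjoint union of two layers all of whose connected components are wheel graphs,
with `2·ord(A₃A₂ᵀ)` resp. `2·ord(B₂B₁ᵀ)` positions per cycle.
[cite: BravyiEtAl2024, Lemma 2 and proof (arXiv:2308.07915 chunk p0010 L49–95, p0011 L1–5)] -/
theorem exists_wheel_layers {g₁ g₂ g₃ h₁ h₂ h₃ : Mono ℓ m}
    (hg₁₂ : g₁ ≠ g₂) (hg₁₃ : g₁ ≠ g₃) (hg₂₃ : g₂ ≠ g₃) (hh₁₂ : h₁ ≠ h₂) (hh₁₃ : h₁ ≠ h₃) (hh₂₃ : h₂ ≠ h₃)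
    (hA : ∀ g, C.A g ≠ 0 ↔ g = g₁ ∨ g = g₂ ∨ g = g₃) (hB : ∀ g, C.B g ≠ 0 ↔ g = h₁ ∨ g = h₂ ∨ g = h₃) :
    ∃ ΓA ΓB : SimpleGraph ((Mono ℓ m ⊕ Mono ℓ m) ⊕ (Mono ℓ m ⊕ Mono ℓ m)),
      C.css.tannerGraph = ΓA ⊔ ΓB ∧ Disjoint ΓA ΓB ∧
      (∀ K : ΓA.ConnectedComponent, Nonempty (K.toSimpleGraph ≃g prismGraph (2 * addOrderOf (g₃ - g₂)))) ∧
      (∀ K : ΓB.ConnectedComponent, Nonempty (K.toSimpleGraph ≃g prismGraph (2 * addOrderOf (h₂ - h₁)))) := by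
  have ha : ∀ g, coeffVec C.A g ≠ 0 ↔ g = -g₁ ∨ g = -g₂ ∨ g = -g₃ := by
    intro g; simp only [coeffVec_apply, hA (-g), neg_eq_iff_eq_neg]
  have hb : ∀ g, coeffVec C.B g ≠ 0 ↔ g = -h₁ ∨ g = -h₂ ∨ g = -h₃ := by
    intro g; simp only [coeffVec_apply, hB (-g), neg_eq_iff_eq_neg]
  have key := AbelianTwoBlock.exists_wheel_layers (a := coeffVec C.A) (b := coeffVec C.B)
    (neg_injective.ne hg₁₂) (neg_injective.ne hg₁₃) (neg_injective.ne hg₂₃)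
    (neg_injective.ne hh₁₂) (neg_injective.ne hh₁₃) (neg_injective.ne hh₂₃) ha hb
  have e1 : -g₃ - -g₂ = -(g₃ - g₂) := by abel
  have e2 : -h₂ - -h₁ = -(h₂ - h₁) := by abel
  rw [e1, e2, addOrderOf_neg, addOrderOf_neg] at key
  exact key

end BB.Code

end Literature.InformationTheory.QuantumCodes
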